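import Literature.Computability.Complexity.HeavyStringsEnumeration
import Literature.Computability.Complexity.SamplingEstimate
import HarnessLib

/-!
# Finding an element of a dense polynomial-time decidable set, under `PromiseBPP' ⊆ PromiseP`

Topic `Literature/Computability/Complexity`, toolkit of derandomisation under the hypothesis
`pr-BPP = pr-P` (the inclusion `PromiseBPP' ⊆ PromiseP` of the promise classes of `Promise.lean`),
companion of `HeavyStringsEnumeration.lean`. Setting: a polynomial-time one-bit test `G ∈ FP`
("`w` is good" iff `G w = [1]`) and a length `N` at which the good strings are DENSE,
`Pr_{w ∈ {0,1}^N}[G w = [1]] > 2N/(m(N)+1)` for a polynomial `m`. Main result: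

* `DenseSearch.exists_finder_of_PromiseBPP'_subset` — **if `PromiseBPP' ⊆ PromiseP` then some `F ∈ FP`
  returns, on every input `u`, a string `F u` of the same length `N = |u|` which is good whenever the
  good strings of length `N` have density `> 2N/(m(N)+1)`.**

This is the "explicit construction" consequence of full derandomisation (Goldreich 2011, *In a world
of P = BPP*, §3: BPP-search problems whose solutions are recognised in deterministic polynomial time
are solved deterministically under `pr-BPP = pr-P`; the textbook instance being "find an `N`-bit
prime"), by the method of conditional probabilities with APPROXIMATE conditional densities:

* the conditional density `q(p) = Pr_s[G (p s) = 1]` of a prefix `p` (`dens`) satisfies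
  `q(p) = (q(p0) + q(p1))/2` (`dens_split`) and `q(w) = [G w = 1]` at full length (`dens_full`);
* the THRESHOLD PROBLEM "`q(p) ≥ (t+1)/M`" versus "`q(p) ≤ t/M`" on instances `⟨⟨u, p⟩, ⟨1ᵗ, 1ᴹ⟩⟩`
  (`thrProblem`) is in `PromiseBPP'` (`thrProblem_mem_PromiseBPP'`): sample `K = 16 |x|²` suffixes,
  accept iff at least a `(t + 1/2)/M` fraction is good (`verF`, the counting fold `BPPAmp.countF` of
  `BPPErrorReductionStrong.lean`), correct with probability `≥ 1 - e^{-2} ≥ 2/3` on the promise by the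
  two-sided sampling estimate (Hoeffding, `BPPAmp.uniformProb_nbad_ge_le` / `_le_le`);
* a separator `LF ∈ P` of the threshold problem yields the ESTIMATE
  `e(p) = #{t ≤ M | ⟨⟨u, p⟩, ⟨1ᵗ, 1ᴹ⟩⟩ ∈ LF}` with `|e(p)/M - q(p)| ≤ 1/M` (`est_gt`, `est_lt`: the
  thresholds below `⌊qM⌋` are forced in, those from `⌈qM⌉` on are forced out);
* the GREEDY PREFIX EXTENSION `p ↦ p b`, `b = [e(p0) < e(p1)]`, loses at most `2/M` of density per
  step (`dens_step`), so after `N` steps from the empty prefix the density is still positive, i.e. the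
  string reached is good (`dens_pref`, `good_pref`);
* the whole search is one `FP` function (`finderF`, `finderF_mem_FP`, `finderF_apply`): the estimate
  is a counted fold (`foldLoop`, `foldAcc_addFn`) of the separator's indicator, the `N` rounds an
  iteration with linear growth (`iterate_mem_FP_of_growth_poly`).

Everything is proved; the definitions are the bricks of the two machines. No named fact is introduced.
First client: a `2^{εn}`-hard language in `E` under `DistNP ⊆ AvgP` and `pr-BPP = pr-P`, from the
Köbler–Schuler certifier of hard truth tables (`MetaComplexity/AvgCaseHardEFromPromiseBPP.lean`).

## References

* O. Goldreich, *In a world of P = BPP*, in: Studies in Complexity and Cryptography, LNCS 6650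
  (2011) 191–232, §3 (Thm. 3.5: BPP-search problems under `pr-BPP = pr-P`; the bit-by-bit extension
  with approximate thresholds) [Goldreich2011].
* O. Goldreich, *On promise problems: a survey*, LNCS 3895 (2006), §1.2, Def. 1.2 (promise-BPP)
  [Goldreich2006].
* S. Arora, B. Barak, *Computational Complexity: A Modern Approach*, CUP 2009, §7.4.1 (sampling and
  the Chernoff bound), §1.3–1.4 (polynomial time under composition and bounded loops) [AroraBarakCC2009].
* W. Hoeffding, *Probability inequalities for sums of bounded random variables*, JASA 58 (1963), Thm. 2
  [Hoeffding1963].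
-/

noncomputable section

namespace Literature.Computability.Complexity

open _root_.Computability Polynomial Finset Brick Plumb HashBricks OracleCompose

namespace DenseSearch

variable (G : List Bool → List Bool)

/-! ### Conditional densities of good extensions -/

/-- **The conditional density of a prefix**: `dens G N p = Pr_{s ∈ {0,1}^{N-|p|}}[G (p s) = [1]]`, the
fraction of good extensions of `p` to length `N`. [Goldreich 2011, §3 (proof of Thm. 3.5)] [folklore] -/
def dens (N : ℕ) (p : List Bool) : ℝ := uniformProb (N - p.length) {s | G (p ++ s) = [true]}

variable {G}

/-- Densities are nonnegative. [folklore] -/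
theorem dens_nonneg (N : ℕ) (p : List Bool) : 0 ≤ dens G N p := uniformProb_nonneg _ _

/-- Densities are at most `1`. [folklore] -/
theorem dens_le_one (N : ℕ) (p : List Bool) : dens G N p ≤ 1 := uniformProb_le_one _ _

/-- **Splitting on the next symbol**: `q(p) = (q(p0) + q(p1))/2` for `|p| < N`. [folklore] -/
theorem dens_split {N : ℕ} {p : List Bool} (hp : p.length < N) :
    dens G N p = (dens G N (p ++ [false]) + dens G N (p ++ [true])) / 2 := by
  unfold dens
  have hlen : N - p.length = (N - (p ++ [false]).length) + 1 := by simp; omega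
  have hlen' : (p ++ [true]).length = (p ++ [false]).length := by simp
  rw [hlen', hlen, uniformProb_eq_cnt_div, uniformProb_eq_cnt_div, uniformProb_eq_cnt_div, cnt_succ, pow_succ]
  have h0 : {y : List Bool | false :: y ∈ {s : List Bool | G (p ++ s) = [true]}} = {s | G (p ++ [false] ++ s) = [true]} := by
    ext y; simp
  have h1 : {y : List Bool | true :: y ∈ {s : List Bool | G (p ++ s) = [true]}} = {s | G (p ++ [true] ++ s) = [true]} := by
    ext y; simp
  rw [h0, h1, Nat.cast_add]
  field_simp

/-- **Full length**: `q(w) = [G w = [1]]` for `|w| = N`. [folklore] -/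
theorem dens_full {N : ℕ} {p : List Bool} (hp : p.length = N) :
    dens G N p = if G p = [true] then 1 else 0 := by
  classical
  unfold dens
  rw [hp, Nat.sub_self, uniformProb_eq_cnt_div, cnt_zero, pow_zero, div_one]
  simp only [Set.mem_setOf_eq, List.append_nil]
  split_ifs <;> simp

/-- The density of the empty prefix is the density of the good strings of length `N`. [folklore] -/
theorem dens_nil (N : ℕ) : dens G N [] = uniformProb N {w | G w = [true]} := by
  simp [dens]

/-- The larger of the two one-symbol extensions has at least the density of the prefix. [folklore] -/
theorem dens_le_max {N : ℕ} {p : List Bool} (hp : p.length < N) :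
    dens G N p ≤ max (dens G N (p ++ [false])) (dens G N (p ++ [true])) := by
  rw [dens_split hp]
  have h0 := le_max_left (dens G N (p ++ [false])) (dens G N (p ++ [true]))
  have h1 := le_max_right (dens G N (p ++ [false])) (dens G N (p ++ [true]))
  linarith

/-! ### The threshold promise problem -/

/-- **The instance code** `⟨⟨u, p⟩, ⟨1ᵗ, 1ᴹ⟩⟩`: target length `N = |u|`, prefix `p`, threshold index `t`,
resolution `M`. [folklore] -/
def code (u p : List Bool) (t M : ℕ) : List Bool := boolPair (boolPair u p) (boolPair (ones t) (ones M))

variable (G)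

/-- **The threshold problem**: yes iff `q(p) ≥ (t+1)/M`, no iff `q(p) ≤ t/M` (with `M ≥ 1`).
[Goldreich 2011, §3 (proof of Thm. 3.5: approximating the residual success probability)] [folklore] -/
def thrProblem : PromiseProblem :=
  ⟨{v | ∃ (u p : List Bool) (t M : ℕ), v = code u p t M ∧ 1 ≤ M ∧ ((t : ℝ) + 1) / M ≤ dens G u.length p},
   {v | ∃ (u p : List Bool) (t M : ℕ), v = code u p t M ∧ 1 ≤ M ∧ dens G u.length p ≤ (t : ℝ) / M}⟩

/-! ### The sampling test: `K = 16|x|²` suffixes, accept iff `16|x|²(2t+1) ≤ 2M · #good` -/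

/-- On `w = ⟨x, blk⟩`, `x = ⟨⟨u, p⟩, ⟨1ᵗ, 1ᴹ⟩⟩`: the prefix `p`. [folklore] -/
def pW : List Bool → List Bool := sndF ∘ fstF ∘ fstF
/-- On `w`: the target string `u`. [folklore] -/
def uW : List Bool → List Bool := fstF ∘ fstF ∘ fstF
/-- On `w`: a word of length `|u| - |p|` (the suffix length). [folklore] -/
def cW : List Bool → List Bool := dropFn ∘ fanoutFn pW uW
/-- **The block test** `⟨x, blk⟩ ↦ G (p ++ blk ↾ (|u| - |p|))`. [folklore] -/
def btF : List Bool → List Bool := G ∘ appF ∘ fanoutFn pW (takeFn ∘ fanoutFn cW sndF)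
/-- The block-test language. [folklore] -/
def BT : Language Bool := {w | btF G w = [true]}

/-- The number of samples as a numeral: `w ↦ bin (16 |x|²)`. [folklore] -/
def kBinF : List Bool → List Bool := lenBinF ∘ polyFn (16 * X ^ 2) ∘ fstF
/-- `1ᵗ` from `w`. [folklore] -/
def tW : List Bool → List Bool := fstF ∘ sndF ∘ fstF
/-- `1ᴹ` from `w`. [folklore] -/
def mW : List Bool → List Bool := sndF ∘ sndF ∘ fstF
/-- `bin (2t+1)`. [folklore] -/
def t21F : List Bool → List Bool := lenBinF ∘ List.cons true ∘ appF ∘ fanoutFn tW tW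
/-- `bin (2M)`. [folklore] -/
def m2F : List Bool → List Bool := lenBinF ∘ appF ∘ fanoutFn mW mW
/-- `bin (16|x|²(2t+1))`. [folklore] -/
def lhsF : List Bool → List Bool := prodFn ∘ fanoutFn kBinF t21F
/-- `bin (2M · #good samples)` (the count by `BPPAmp.countF`, blocks of length `|x|`). [folklore] -/
def rhsF : List Bool → List Bool := prodFn ∘ fanoutFn m2F (BPPAmp.countF (BT G) X (16 * X ^ 2))
/-- **The verdict** `[16|x|²(2t+1) ≤ 2M · #good]`. [Arora–Barak 2009, §7.4.1 (sampling)] [folklore] -/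
def verF : List Bool → List Bool := notFn (ltFn ∘ fanoutFn (rhsF G) lhsF)
/-- The witness language of the sampling test. [folklore] -/
def W : Language Bool := {w | verF G w = [true]}

variable {G}

/-- Value of the block test. [folklore] -/
theorem btF_apply (u p : List Bool) (t M : ℕ) (blk : List Bool) :
    btF G (boolPair (code u p t M) blk) = G (p ++ blk.take (u.length - p.length)) := by
  simp [btF, pW, uW, cW, code]

/-- Membership in the block-test language. [folklore] -/
theorem boolPair_mem_BT (u p : List Bool) (t M : ℕ) (blk : List Bool) :
    boolPair (code u p t M) blk ∈ BT G ↔ G (p ++ blk.take (u.length - p.length)) = [true] := by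
  change btF G _ = [true] ↔ _
  rw [btF_apply]

/-- `btF ∈ FP` for `G ∈ FP`. [folklore] -/
theorem btF_mem_FP (hG : G ∈ FP) : btF G ∈ FP := by
  have hp : pW ∈ FP := comp_mem_FP sndF_mem_FP (comp_mem_FP fstF_mem_FP fstF_mem_FP)
  have hu : uW ∈ FP := comp_mem_FP fstF_mem_FP (comp_mem_FP fstF_mem_FP fstF_mem_FP)
  have hc : cW ∈ FP := comp_mem_FP dropFn_mem_FP (fanoutFn_mem_FP hp hu)
  exact comp_mem_FP hG (comp_mem_FP appF_mem_FP (fanoutFn_mem_FP hp (comp_mem_FP takeFn_mem_FP (fanoutFn_mem_FP hc sndF_mem_FP))))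

/-- The block-test language is in `P`. [folklore] -/
theorem BT_mem_P (hG : G ∈ FP) : BT G ∈ Classes.P :=
  setOf_apply_eq_apply_mem_P (btF_mem_FP hG) (const_mem_FP _)

/-- The length of an instance code is at least `M` and at least `|u|`. [folklore] -/
theorem length_code_ge (u p : List Bool) (t M : ℕ) : M ≤ (code u p t M).length ∧ u.length ≤ (code u p t M).length := by
  simp only [code, length_boolPair, ones, List.length_replicate]
  omega

/-- **Value of the verdict** on `⟨x, y⟩`, `x = ⟨⟨u, p⟩, ⟨1ᵗ, 1ᴹ⟩⟩`. [folklore] -/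
theorem verF_apply (u p : List Bool) (t M : ℕ) (y : List Bool) :
    verF G (boolPair (code u p t M) y) =
      [decide (16 * (code u p t M).length ^ 2 * (2 * t + 1) ≤
        2 * M * BPPAmp.count (BT G) X (16 * X ^ 2) (code u p t M) y)] := by
  have hl : lhsF (boolPair (code u p t M) y) = encodeNat (16 * (code u p t M).length ^ 2 * (2 * t + 1)) := by
    have h1 : (true :: (ones t ++ ones t)).length = 2 * t + 1 := by simp [ones]; omega
    simp only [lhsF, kBinF, t21F, tW, Function.comp_apply, fanoutFn_apply, fstF_boolPair, sndF_boolPair, polyFn_apply,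
      lenBinF_apply, appF_boolPair, prodFn_boolPair, bitsToNat_encodeNat, code, h1]
    simp [ones]
  have hr : rhsF G (boolPair (code u p t M) y) = encodeNat (2 * M * BPPAmp.count (BT G) X (16 * X ^ 2) (code u p t M) y) := by
    have h1 : (ones M ++ ones M).length = 2 * M := by simp [ones]; omega
    rw [rhsF, Function.comp_apply, fanoutFn_apply, BPPAmp.countF_apply, prodFn_boolPair, bitsToNat_encodeNat]
    simp only [m2F, mW, Function.comp_apply, fanoutFn_apply, fstF_boolPair, sndF_boolPair, lenBinF_apply, appF_boolPair,
      bitsToNat_encodeNat, code, h1]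
  have hlt : (ltFn ∘ fanoutFn (rhsF G) lhsF) (boolPair (code u p t M) y) =
      [decide (2 * M * BPPAmp.count (BT G) X (16 * X ^ 2) (code u p t M) y < 16 * (code u p t M).length ^ 2 * (2 * t + 1))] := by
    simp only [Function.comp_apply, fanoutFn_apply, hl, hr, ltFn_boolPair, bitsToNat_encodeNat]
  rw [show verF G (boolPair (code u p t M) y) = notFn (ltFn ∘ fanoutFn (rhsF G) lhsF) (boolPair (code u p t M) y) from rfl,
    notFn_apply hlt]
  simp only [← decide_not, not_lt]

/-- `verF ∈ FP`. [folklore] -/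
theorem verF_mem_FP (hG : G ∈ FP) : verF G ∈ FP := by
  have ht : tW ∈ FP := comp_mem_FP fstF_mem_FP (comp_mem_FP sndF_mem_FP fstF_mem_FP)
  have hm : mW ∈ FP := comp_mem_FP sndF_mem_FP (comp_mem_FP sndF_mem_FP fstF_mem_FP)
  have hk : kBinF ∈ FP := comp_mem_FP lenBinF_mem_FP (comp_mem_FP (polyFn_mem_FP _) fstF_mem_FP)
  have h21 : t21F ∈ FP :=
    comp_mem_FP lenBinF_mem_FP (comp_mem_FP (cons_mem_FP true) (comp_mem_FP appF_mem_FP (fanoutFn_mem_FP ht ht)))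
  have h2 : m2F ∈ FP := comp_mem_FP lenBinF_mem_FP (comp_mem_FP appF_mem_FP (fanoutFn_mem_FP hm hm))
  have hl : lhsF ∈ FP := comp_mem_FP prodFn_mem_FP (fanoutFn_mem_FP hk h21)
  have hr : rhsF G ∈ FP := comp_mem_FP prodFn_mem_FP (fanoutFn_mem_FP h2 (BPPAmp.countF_mem_FP X (16 * X ^ 2) (BT_mem_P hG)))
  exact notFn_mem_FP (comp_mem_FP ltFn_mem_FP (fanoutFn_mem_FP hr hl))

/-- The witness language is in `P`. [folklore] -/
theorem W_mem_P (hG : G ∈ FP) : W G ∈ Classes.P :=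
  setOf_apply_eq_apply_mem_P (verF_mem_FP hG) (const_mem_FP _)

/-! ### The threshold problem is in `PromiseBPP'` -/

/-- Monotonicity of `uniformProb` (local copy). [folklore] -/
private theorem prob_mono {m : ℕ} {E F : Set (List Bool)} (h : E ⊆ F) : uniformProb m E ≤ uniformProb m F := by
  classical
  unfold uniformProb
  refine div_le_div_of_nonneg_right ?_ (by positivity)
  exact_mod_cast Finset.card_le_card fun r hr => by
    simp only [Finset.mem_filter, Finset.mem_univ, true_and] at hr ⊢
    exact h hr

/-- `uniformProb` depends only on the strings of length `m` (local copy). [folklore] -/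
private theorem prob_congr {m : ℕ} {E E' : Set (List Bool)} (h : ∀ y : List Bool, y.length = m → (y ∈ E ↔ y ∈ E')) :
    uniformProb m E = uniformProb m E' := by
  rw [uniformProb_eq_cnt_div, uniformProb_eq_cnt_div, cnt_congr h]

/-- The fold's count is the number of blocks in the block event (`BPPAmp.nbad`). [folklore] -/
theorem count_eq_nbad (L' : Language Bool) (P T : Polynomial ℕ) (x y : List Bool) :
    BPPAmp.count L' P T x y = BPPAmp.nbad (T.eval x.length) (P.eval x.length) {blk | boolPair x blk ∈ L'} y := by
  unfold BPPAmp.count BPPAmp.nbad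
  refine Finset.sum_congr rfl fun j _ => ?_
  by_cases hj : boolPair x (BPPAmp.block (P.eval x.length) j y) ∈ L'
  · simp [hj, (Set.mem_iff_boolIndicator _ _).1 hj]
  · simp [hj, (Set.notMem_iff_boolIndicator _ _).1 hj]

/-- **The block event has the density of the prefix**: a uniform block of length `|x|` read through the
block test is a uniform suffix of length `|u| - |p|` (cylinder rule). [folklore] -/
theorem uniformProb_BT (u p : List Bool) (t M : ℕ) :
    uniformProb (code u p t M).length {blk | boolPair (code u p t M) blk ∈ BT G} = dens G u.length p := by
  have hC : u.length - p.length ≤ (code u p t M).length := by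
    have := (length_code_ge u p t M).2; omega
  unfold dens
  rw [← uniformProb_take_of_le hC]
  refine prob_congr fun blk _ => ?_
  simp only [Set.mem_setOf_eq, boolPair_mem_BT]

/-- `e^{-2} ≤ 1/3`. [folklore] -/
theorem exp_neg_two_le_third : Real.exp (-2) ≤ 1 / 3 := by
  rw [Real.exp_neg, inv_eq_one_div, div_le_div_iff_of_pos_left one_pos (Real.exp_pos 2) (by norm_num)]
  have := Real.add_one_le_exp (2 : ℝ)
  linarith

/-- The exponent of the sampling estimate: with `K = 16 n² ≥ 16 M²` samples and deviation `θ = 1/(2M)`,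
`θ² K / 2 ≥ 2`. [folklore] -/
theorem exp_bound {n M : ℕ} (hM : 1 ≤ M) (hMn : M ≤ n) :
    Real.exp (-((1 / (2 * (M : ℝ))) ^ 2 * ((16 * n ^ 2 : ℕ) : ℝ) / 2)) ≤ 1 / 3 := by
  refine le_trans (Real.exp_le_exp.2 ?_) exp_neg_two_le_third
  have hM' : (0 : ℝ) < M := by exact_mod_cast hM
  have hMn' : (M : ℝ) ≤ n := by exact_mod_cast hMn
  have key : (1 / (2 * (M : ℝ))) ^ 2 * ((16 * n ^ 2 : ℕ) : ℝ) / 2 = 2 * ((n : ℝ) / M) ^ 2 := by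
    push_cast
    field_simp
    ring
  rw [key, neg_le_neg_iff]
  have h1 : (1 : ℝ) ≤ (n : ℝ) / M := by rw [le_div_iff₀ hM', one_mul]; exact hMn'
  nlinarith

/-- Reading the verdict off membership in `W`. [folklore] -/
theorem boolPair_mem_W_iff (u p : List Bool) (t M : ℕ) (y : List Bool) :
    boolPair (code u p t M) y ∈ W G ↔
      16 * (code u p t M).length ^ 2 * (2 * t + 1) ≤ 2 * M * BPPAmp.count (BT G) X (16 * X ^ 2) (code u p t M) y := by
  change verF G (boolPair (code u p t M) y) = [true] ↔ _
  rw [verF_apply]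
  simp

/-- **The threshold problem is in `PromiseBPP'`** for `G ∈ FP`: witness the sampling test `W`, coins
`16 |x|³` (`16|x|²` blocks of length `|x|`). On a yes-instance (`q ≥ (t+1)/M`) rejection means at most
`K (q - 1/(2M))` good samples, on a no-instance (`q ≤ t/M`) acceptance means at least `K (q + 1/(2M))`;
either deviation has probability `≤ e^{-K/(8M²)} ≤ e^{-2} ≤ 1/3` by Hoeffding's inequality.
[Arora–Barak 2009, §7.4.1; Goldreich 2011, §3] [cite: Hoeffding1963, Thm. 2] -/
theorem thrProblem_mem_PromiseBPP' (hG : G ∈ FP) : thrProblem G ∈ PromiseBPP' := by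
  refine ⟨W G, W_mem_P hG, 16 * X ^ 3, ?_, ?_⟩
  · rintro v ⟨u, p, t, M, rfl, hM, hyes⟩
    set n := (code u p t M).length with hn
    have hMn : M ≤ n := (length_code_ge u p t M).1
    have hn1 : 1 ≤ n := hM.trans hMn
    have hK : 0 < 16 * n ^ 2 := by positivity
    have hM' : (0 : ℝ) < M := by exact_mod_cast hM
    have hcoins : (16 * X ^ 3 : Polynomial ℕ).eval n = 16 * n ^ 2 * n := by simp [eval_pow]; ring
    set E : Set (List Bool) := {blk | boolPair (code u p t M) blk ∈ BT G} with hE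
    have hdensE : uniformProb n E = dens G u.length p := uniformProb_BT u p t M
    -- rejection forces a low count
    have hsub : {y : List Bool | boolPair (code u p t M) y ∈ W G}ᶜ ⊆
        {y | (BPPAmp.nbad (16 * n ^ 2) n E y : ℝ) ≤ (16 * n ^ 2 : ℕ) * (uniformProb n E - 1 / (2 * M))} := by
      intro y hy
      have hy' : ¬ (16 * n ^ 2 * (2 * t + 1) ≤ 2 * M * BPPAmp.count (BT G) X (16 * X ^ 2) (code u p t M) y) := by
        rw [← boolPair_mem_W_iff]; exact hy
      simp only [Set.mem_setOf_eq]
      have hcount : BPPAmp.count (BT G) X (16 * X ^ 2) (code u p t M) y = BPPAmp.nbad (16 * n ^ 2) n E y := by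
        rw [count_eq_nbad]; simp [← hn, hE]
      rw [← hcount, hdensE]
      have h1 : (2 * M * BPPAmp.count (BT G) X (16 * X ^ 2) (code u p t M) y : ℝ) < 16 * n ^ 2 * (2 * t + 1) := by
        exact_mod_cast not_le.1 hy'
      have h2 : ((16 * n ^ 2 : ℕ) : ℝ) * (((t : ℝ) + 1) / M - 1 / (2 * M)) ≤ (16 * n ^ 2 : ℕ) * (dens G u.length p - 1 / (2 * M)) :=
        mul_le_mul_of_nonneg_left (by linarith) (by positivity)
      refine le_trans (le_of_lt ?_) h2
      rw [← sub_pos] at h1 ⊢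
      have : ((16 * n ^ 2 : ℕ) : ℝ) * (((t : ℝ) + 1) / M - 1 / (2 * M)) - BPPAmp.count (BT G) X (16 * X ^ 2) (code u p t M) y =
          (16 * n ^ 2 * (2 * t + 1) - 2 * M * (BPPAmp.count (BT G) X (16 * X ^ 2) (code u p t M) y : ℝ)) / (2 * M) := by
        push_cast; field_simp; ring
      rw [this]; positivity
    have hbad := BPPAmp.uniformProb_nbad_le_le (t := 16 * n ^ 2) (P := n) E hK (θ := 1 / (2 * M)) (by positivity)
    have hle := (prob_mono hsub).trans (hbad.trans (exp_bound hM hMn))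
    have hcompl := uniformProb_compl (16 * n ^ 2 * n) {y : List Bool | boolPair (code u p t M) y ∈ W G}
    rw [hcoins]
    linarith
  · rintro v ⟨u, p, t, M, rfl, hM, hno⟩
    set n := (code u p t M).length with hn
    have hMn : M ≤ n := (length_code_ge u p t M).1
    have hn1 : 1 ≤ n := hM.trans hMn
    have hK : 0 < 16 * n ^ 2 := by positivity
    have hM' : (0 : ℝ) < M := by exact_mod_cast hM
    have hcoins : (16 * X ^ 3 : Polynomial ℕ).eval n = 16 * n ^ 2 * n := by simp [eval_pow]; ring
    set E : Set (List Bool) := {blk | boolPair (code u p t M) blk ∈ BT G} with hE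
    have hdensE : uniformProb n E = dens G u.length p := uniformProb_BT u p t M
    -- acceptance forces a high count
    have hsub : {y : List Bool | boolPair (code u p t M) y ∈ W G} ⊆
        {y | ((16 * n ^ 2 : ℕ) : ℝ) * (uniformProb n E + 1 / (2 * M)) ≤ BPPAmp.nbad (16 * n ^ 2) n E y} := by
      intro y hy
      have hy' : 16 * n ^ 2 * (2 * t + 1) ≤ 2 * M * BPPAmp.count (BT G) X (16 * X ^ 2) (code u p t M) y := by
        rw [← boolPair_mem_W_iff]; exact hy
      simp only [Set.mem_setOf_eq]
      have hcount : BPPAmp.count (BT G) X (16 * X ^ 2) (code u p t M) y = BPPAmp.nbad (16 * n ^ 2) n E y := by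
        rw [count_eq_nbad]; simp [← hn, hE]
      rw [← hcount, hdensE]
      have h1 : (16 * n ^ 2 * (2 * t + 1) : ℝ) ≤ 2 * M * BPPAmp.count (BT G) X (16 * X ^ 2) (code u p t M) y := by
        exact_mod_cast hy'
      have h2 : ((16 * n ^ 2 : ℕ) : ℝ) * (dens G u.length p + 1 / (2 * M)) ≤ (16 * n ^ 2 : ℕ) * ((t : ℝ) / M + 1 / (2 * M)) :=
        mul_le_mul_of_nonneg_left (by linarith) (by positivity)
      refine h2.trans ?_
      rw [← sub_nonneg] at h1 ⊢
      have : (BPPAmp.count (BT G) X (16 * X ^ 2) (code u p t M) y : ℝ) - ((16 * n ^ 2 : ℕ) : ℝ) * ((t : ℝ) / M + 1 / (2 * M)) =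
          (2 * M * (BPPAmp.count (BT G) X (16 * X ^ 2) (code u p t M) y : ℝ) - 16 * n ^ 2 * (2 * t + 1)) / (2 * M) := by
        push_cast; field_simp
      rw [this]; positivity
    have hbad := BPPAmp.uniformProb_nbad_ge_le (t := 16 * n ^ 2) (P := n) E hK (θ := 1 / (2 * M)) (by positivity)
    have hle := (prob_mono hsub).trans (hbad.trans (exp_bound hM hMn))
    have hcompl := uniformProb_compl (16 * n ^ 2 * n) {y : List Bool | boolPair (code u p t M) y ∈ W G}
    rw [hcoins]
    have hset : {y : List Bool | boolPair (code u p t M) y ∉ W G} = {y : List Bool | boolPair (code u p t M) y ∈ W G}ᶜ := rfl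
    rw [hset, hcompl]
    linarith

/-- Decoding a yes-instance. [folklore] -/
theorem code_mem_yes {u p : List Bool} {t M : ℕ} (hM : 1 ≤ M) (h : ((t : ℝ) + 1) / M ≤ dens G u.length p) :
    code u p t M ∈ (thrProblem G).yes := ⟨u, p, t, M, rfl, hM, h⟩

/-- Decoding a no-instance. [folklore] -/
theorem code_mem_no {u p : List Bool} {t M : ℕ} (hM : 1 ≤ M) (h : dens G u.length p ≤ (t : ℝ) / M) :
    code u p t M ∈ (thrProblem G).no := ⟨u, p, t, M, rfl, hM, h⟩

/-! ### Estimates read off a separator, the greedy step, the greedy prefixes -/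

section Greedy

variable (LF : Set (List Bool))

open scoped Classical in
/-- **The estimate** `e(p) = #{t ≤ M | ⟨⟨u, p⟩, ⟨1ᵗ, 1ᴹ⟩⟩ ∈ LF}` read off a separator `LF` of the threshold
problem. [Goldreich 2011, §3 (proof of Thm. 3.5)] [folklore] -/
def est (u p : List Bool) (M : ℕ) : ℕ := ∑ t ∈ range (M + 1), if code u p t M ∈ LF then 1 else 0

/-- **The greedy choice** of the next symbol: `1` iff `e(p1) > e(p0)`. [Goldreich 2011, §3] [folklore] -/
def choice (u p : List Bool) (M : ℕ) : Bool := decide (est LF u (p ++ [false]) M < est LF u (p ++ [true]) M)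

/-- **The greedy prefixes** `p₀ = ε`, `p_{k+1} = p_k b_k`. [Goldreich 2011, §3 (the bit-by-bit extension)] [folklore] -/
def pref (u : List Bool) (M : ℕ) : ℕ → List Bool
  | 0 => []
  | k + 1 => pref u M k ++ [choice LF u (pref u M k) M]

variable {LF}

/-- The `k`-th greedy prefix has length `k`. [folklore] -/
@[simp] theorem length_pref (u : List Bool) (M : ℕ) : ∀ k, (pref LF u M k).length = k
  | 0 => rfl
  | k + 1 => by rw [pref, List.length_append, length_pref u M k, List.length_singleton]

open scoped Classical in
/-- The estimate as a cardinality. [folklore] -/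
theorem est_eq_card (u p : List Bool) (M : ℕ) :
    est LF u p M = ((range (M + 1)).filter fun t => code u p t M ∈ LF).card := by
  rw [est, Finset.card_filter]

/-- **Lower estimate**: the thresholds `t < ⌊qM⌋` are yes-instances, hence accepted: `qM - 1 < e(p)`.
[Goldreich 2011, §3] [folklore] -/
theorem est_gt (hyes : (thrProblem G).yes ≤ LF) (u p : List Bool) {M : ℕ} (hM : 1 ≤ M) :
    dens G u.length p * M - 1 < est LF u p M := by
  classical
  set q := dens G u.length p with hq
  have hq0 : 0 ≤ q := dens_nonneg _ _
  have hq1 : q ≤ 1 := dens_le_one _ _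
  have hM' : (0 : ℝ) < M := by exact_mod_cast hM
  have hsub : range ⌊q * M⌋₊ ⊆ (range (M + 1)).filter (fun t => code u p t M ∈ LF) := by
    intro t ht
    rw [mem_range] at ht
    rw [mem_filter, mem_range]
    have htle : (t : ℝ) + 1 ≤ q * M := by
      have h1 : (⌊q * M⌋₊ : ℝ) ≤ q * M := Nat.floor_le (by positivity)
      have h2 : ((t + 1 : ℕ) : ℝ) ≤ (⌊q * M⌋₊ : ℝ) := by exact_mod_cast ht
      push_cast at h2
      linarith
    refine ⟨?_, hyes (code_mem_yes hM ?_)⟩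
    · have h3 : (t : ℝ) + 1 ≤ M := htle.trans (by nlinarith)
      have h4 : ((t + 1 : ℕ) : ℝ) ≤ (M : ℝ) := by push_cast; exact h3
      have h5 : t + 1 ≤ M := by exact_mod_cast h4
      omega
    · rw [div_le_iff₀ hM']; exact htle
  have hcard := Finset.card_le_card hsub
  rw [card_range] at hcard
  rw [est_eq_card]
  calc q * M - 1 < ⌊q * M⌋₊ := by have := Nat.lt_floor_add_one (q * M); linarith
    _ ≤ _ := by exact_mod_cast hcard

/-- **Upper estimate**: an accepted threshold is not a no-instance, so `t < qM`: `e(p) < qM + 1`.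
[Goldreich 2011, §3] [folklore] -/
theorem est_lt (hno : (thrProblem G).no ≤ LFᶜ) (u p : List Bool) {M : ℕ} (hM : 1 ≤ M) :
    (est LF u p M : ℝ) < dens G u.length p * M + 1 := by
  classical
  set q := dens G u.length p with hq
  have hq0 : 0 ≤ q := dens_nonneg _ _
  have hM' : (0 : ℝ) < M := by exact_mod_cast hM
  have hsub : (range (M + 1)).filter (fun t => code u p t M ∈ LF) ⊆ range ⌈q * M⌉₊ := by
    intro t ht
    rw [mem_filter] at ht
    rw [mem_range, Nat.lt_ceil]
    by_contra hge
    push Not at hge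
    exact hno (code_mem_no hM (by rw [le_div_iff₀ hM']; exact hge)) ht.2
  have hcard := Finset.card_le_card hsub
  rw [card_range] at hcard
  rw [est_eq_card]
  calc (((range (M + 1)).filter (fun t => code u p t M ∈ LF)).card : ℝ) ≤ ⌈q * M⌉₊ := by exact_mod_cast hcard
    _ < q * M + 1 := Nat.ceil_lt_add_one (by positivity)

/-- **The greedy step loses at most `2/M` of density**: with `b = [e(p0) < e(p1)]`,
`q(p b) ≥ q(p) - 2/M` — the chosen side has the larger estimate, estimates are `1/M`-accurate, and the
larger true side has density `≥ q(p)`. [Goldreich 2011, §3 (proof of Thm. 3.5)] [folklore] -/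
theorem dens_step (hyes : (thrProblem G).yes ≤ LF) (hno : (thrProblem G).no ≤ LFᶜ) {u : List Bool} {M : ℕ}
    (hM : 1 ≤ M) {p : List Bool} (hp : p.length < u.length) :
    dens G u.length p - 2 / M ≤ dens G u.length (p ++ [choice LF u p M]) := by
  have hM' : (0 : ℝ) < M := by exact_mod_cast hM
  have e0lo := est_gt hyes u (p ++ [false]) hM (LF := LF)
  have e0hi := est_lt hno u (p ++ [false]) hM (LF := LF)
  have e1lo := est_gt hyes u (p ++ [true]) hM (LF := LF)
  have e1hi := est_lt hno u (p ++ [true]) hM (LF := LF)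
  have hmax := dens_le_max (G := G) hp
  have h2M : 1 / (M : ℝ) ≤ 2 / M := by gcongr; norm_num
  have h2M0 : (0 : ℝ) ≤ 2 / M := by positivity
  unfold choice
  by_cases hlt : est LF u (p ++ [false]) M < est LF u (p ++ [true]) M
  · rw [decide_eq_true hlt]
    -- chosen `1`: `e₀ + 1 ≤ e₁`, so `q₀ M - 1 < e₀ ≤ e₁ - 1 < q₁ M`
    have hcast : (est LF u (p ++ [false]) M : ℝ) + 1 ≤ est LF u (p ++ [true]) M := by exact_mod_cast hlt
    have key : dens G u.length (p ++ [false]) - 1 / M < dens G u.length (p ++ [true]) := by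
      have h : (dens G u.length (p ++ [false]) - 1 / M) * M < dens G u.length (p ++ [true]) * M := by
        rw [sub_mul, div_mul_cancel₀ _ hM'.ne']; linarith
      exact lt_of_mul_lt_mul_right h hM'.le
    rcases le_max_iff.1 hmax with h | h <;> linarith
  · rw [decide_eq_false hlt]
    -- chosen `0`: `e₁ ≤ e₀`, so `q₁ M - 1 < e₁ ≤ e₀ < q₀ M + 1`
    have hcast : (est LF u (p ++ [true]) M : ℝ) ≤ est LF u (p ++ [false]) M := by exact_mod_cast not_lt.1 hlt
    have key : dens G u.length (p ++ [true]) - 2 / M < dens G u.length (p ++ [false]) := by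
      have h : (dens G u.length (p ++ [true]) - 2 / M) * M < dens G u.length (p ++ [false]) * M := by
        rw [sub_mul, div_mul_cancel₀ _ hM'.ne']; linarith
      exact lt_of_mul_lt_mul_right h hM'.le
    rcases le_max_iff.1 hmax with h | h <;> linarith

/-- **The greedy prefixes keep density**: `q(p_k) ≥ q(ε) - 2k/M` for `k ≤ N`. [Goldreich 2011, §3] [folklore] -/
theorem dens_pref (hyes : (thrProblem G).yes ≤ LF) (hno : (thrProblem G).no ≤ LFᶜ) {u : List Bool} {M : ℕ}
    (hM : 1 ≤ M) : ∀ k : ℕ, k ≤ u.length → dens G u.length [] - 2 * k / M ≤ dens G u.length (pref LF u M k)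
  | 0, _ => by simp [pref]
  | k + 1, hk => by
    have ih := dens_pref hyes hno hM (u := u) k (by omega)
    have hstep := dens_step hyes hno hM (LF := LF) (u := u) (p := pref LF u M k) (by rw [length_pref]; omega)
    rw [pref]
    push_cast
    have : dens G u.length [] - 2 * ((k : ℝ) + 1) / M = (dens G u.length [] - 2 * k / M) - 2 / M := by ring
    linarith

/-- **The greedy search succeeds on dense instances**: if `q(ε) > 2N/M` then the prefix of length
`N = |u|` reached is good. [Goldreich 2011, §3 (Thm. 3.5)] [folklore] -/
theorem good_pref (hyes : (thrProblem G).yes ≤ LF) (hno : (thrProblem G).no ≤ LFᶜ) {u : List Bool} {M : ℕ}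
    (hM : 1 ≤ M) (hdense : 2 * (u.length : ℝ) / M < dens G u.length []) :
    G (pref LF u M u.length) = [true] := by
  have h := dens_pref hyes hno hM (LF := LF) (u := u) u.length le_rfl
  have hpos : 0 < dens G u.length (pref LF u M u.length) := by linarith
  rw [dens_full (length_pref u M u.length)] at hpos
  by_contra hne
  rw [if_neg hne] at hpos
  exact lt_irrefl _ hpos

end Greedy

/-! ### The estimate is a polynomial-time function of `⟨⟨u, p⟩, 1ᴹ⟩` -/

section Machines

variable (indF : List Bool → List Bool)

/-- On the piece argument `⟨X₀, 1ᵗ⟩`, `X₀ = ⟨⟨u, p⟩, 1ᴹ⟩`: the instance code `⟨⟨u, p⟩, ⟨1ᵗ, 1ᴹ⟩⟩`. [folklore] -/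
def codeF : List Bool → List Bool := fanoutFn (fstF ∘ fstF) (fanoutFn sndF (sndF ∘ fstF))
/-- **The piece of the estimate fold**: the separator's indicator on the instance code. [folklore] -/
def pieceE : List Bool → List Bool := indF ∘ codeF
/-- The fold record `⟨X₀, ⟨bin (M+1), ⟨1⁰, bin 0⟩⟩⟩` on `X₀ = ⟨⟨u, p⟩, 1ᴹ⟩`. [folklore] -/
def setupE : List Bool → List Bool :=
  fanoutFn id (fanoutFn (lenBinF ∘ List.cons true ∘ sndF) (fanoutFn (fun _ => []) (fun _ => [])))
/-- **The estimate** `⟨⟨u, p⟩, 1ᴹ⟩ ↦ bin e(p)`: a counted fold (`foldLoop`, `M + 1` rounds) of the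
indicator. [Goldreich 2011, §3; Arora–Barak 2009, §1.3 (bounded loops)] [folklore] -/
def estF : List Bool → List Bool := sndPow 2 ∘ foldLoop addFn (pieceE indF) X ∘ setupE

/-- On the state `z = ⟨u, ⟨1ᴹ, p⟩⟩`: the fold argument `⟨⟨u, p b⟩, 1ᴹ⟩` of the child `p b`. [folklore] -/
def argE (b : Bool) : List Bool → List Bool :=
  fanoutFn (fanoutFn fstF (appF ∘ fanoutFn (sndF ∘ sndF) (fun _ => [b]))) (fstF ∘ sndF)
/-- **The chosen symbol** `[e(p0) < e(p1)]`. [Goldreich 2011, §3] [folklore] -/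
def bitE : List Bool → List Bool := ltFn ∘ fanoutFn (estF indF ∘ argE false) (estF indF ∘ argE true)
/-- **One round of the greedy search**: `⟨u, ⟨1ᴹ, p⟩⟩ ↦ ⟨u, ⟨1ᴹ, p b⟩⟩`. [Goldreich 2011, §3] [folklore] -/
def roundE : List Bool → List Bool := fanoutFn fstF (fanoutFn (fstF ∘ sndF) (appF ∘ fanoutFn (sndF ∘ sndF) (bitE indF)))
/-- `N = |u|` rounds. [folklore] -/
def iterE : List Bool → List Bool := fun z => (roundE indF)^[(X : Polynomial ℕ).eval (boolUnpair z).1.length] z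
/-- The initial state `⟨u, ⟨1^{m(|u|)+1}, ε⟩⟩`. [folklore] -/
def initE (m : Polynomial ℕ) : List Bool → List Bool := fanoutFn id (fanoutFn (List.cons true ∘ polyFn m) (fun _ => []))
/-- **The finder** `u ↦ p_N`, the greedy prefix of length `N = |u|` at resolution `M = m(|u|) + 1`.
[Goldreich 2011, §3 (Thm. 3.5)] [folklore] -/
def finderF (m : Polynomial ℕ) : List Bool → List Bool := sndF ∘ sndF ∘ iterE indF ∘ initE m

variable {indF} {LF : Set (List Bool)}

/-- `bitsToNat` of a single symbol. [folklore] -/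
private theorem bitsToNat_singleton (b : Bool) : bitsToNat [b] = b.toNat := by
  rw [bitsToNat_cons]; simp

/-- Value of the piece on `⟨⟨⟨u, p⟩, 1ᴹ⟩, 1ᵗ⟩`. [folklore] -/
theorem pieceE_apply (hind : ∀ v, indF v = [LF.boolIndicator v]) (u p : List Bool) (M t : ℕ) :
    pieceE indF (boolPair (boolPair (boolPair u p) (ones M)) (ones t)) = [LF.boolIndicator (code u p t M)] := by
  simp [pieceE, codeF, hind, code]

/-- `encodeNat 0 = ε`. [folklore] -/
private theorem encodeNat_zero' : encodeNat 0 = [] := by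
  unfold encodeNat
  rw [Nat.cast_zero]
  rfl

open scoped Classical in
/-- The sum of the indicator bits is the estimate. [folklore] -/
theorem sum_pieceE (hind : ∀ v, indF v = [LF.boolIndicator v]) (u p : List Bool) (M : ℕ) :
    ∑ t ∈ range (M + 1), bitsToNat (pieceE indF (boolPair (boolPair (boolPair u p) (ones M)) (ones (0 + t)))) =
      est LF u p M := by
  unfold est
  refine Finset.sum_congr rfl fun t _ => ?_
  rw [Nat.zero_add, pieceE_apply hind, bitsToNat_singleton]
  by_cases h : code u p t M ∈ LF
  · rw [if_pos h, (Set.mem_iff_boolIndicator _ _).1 h]; rfl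
  · rw [if_neg h, (Set.notMem_iff_boolIndicator _ _).1 h]; rfl

/-- **Value of the estimate** on `⟨⟨u, p⟩, 1ᴹ⟩`: the numeral of `e(p)`. [folklore] -/
theorem estF_apply (hind : ∀ v, indF v = [LF.boolIndicator v]) (u p : List Bool) (M : ℕ) :
    estF indF (boolPair (boolPair u p) (ones M)) = encodeNat (est LF u p M) := by
  have hsetup : setupE (boolPair (boolPair u p) (ones M)) =
      boolPair (boolPair (boolPair u p) (ones M)) (boolPair (encodeNat (M + 1)) (boolPair (ones 0) (encodeNat 0))) := by
    rw [encodeNat_zero']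
    simp [setupE, ones]
  have hk : M + 1 ≤ (X : Polynomial ℕ).eval (boolPair (boolPair u p) (ones M)).length := by
    simp only [eval_X, length_boolPair, ones, List.length_replicate]; omega
  have hfold := foldLoop_apply addFn (pieceE indF) hk 0 (encodeNat 0)
  rw [foldAcc_addFn, Nat.zero_add, sum_pieceE hind] at hfold
  rw [estF, Function.comp_apply, Function.comp_apply, hsetup, hfold, sndPow_succ_boolPair, sndPow_succ_boolPair,
    sndPow_zero_boolPair, Nat.zero_add]

/-- `estF ∈ FP` for a polynomial-time indicator. [Arora–Barak 2009, §1.3–1.4] [folklore] -/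
theorem estF_mem_FP (hind : ∀ v, indF v = [LF.boolIndicator v]) (hindF : indF ∈ FP) : estF indF ∈ FP := by
  have hcode : codeF ∈ FP :=
    fanoutFn_mem_FP (comp_mem_FP fstF_mem_FP fstF_mem_FP) (fanoutFn_mem_FP sndF_mem_FP (comp_mem_FP sndF_mem_FP fstF_mem_FP))
  have hpiece : pieceE indF ∈ FP := comp_mem_FP hindF hcode
  have hpg : ∀ w, (pieceE indF w).length ≤ 1 * ((fstF w).length + 1) := fun w => by
    rw [pieceE, Function.comp_apply, hind]; simp
  have hsetup : setupE ∈ FP :=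
    fanoutFn_mem_FP (PolyTimeComputable.id _) (fanoutFn_mem_FP
      (comp_mem_FP lenBinF_mem_FP (comp_mem_FP (cons_mem_FP true) sndF_mem_FP)) (fanoutFn_mem_FP (const_mem_FP _) (const_mem_FP _)))
  exact comp_mem_FP (sndPow_mem_FP 2) (comp_mem_FP (foldLoop_mem_FP addFn_mem_FP length_addFn_le hpiece hpg X) hsetup)

/-! ### The greedy search is a polynomial-time function -/

/-- Value of the fold argument of a child. [folklore] -/
theorem argE_apply (b : Bool) (u p : List Bool) (M : ℕ) :
    argE b (boolPair u (boolPair (ones M) p)) = boolPair (boolPair u (p ++ [b])) (ones M) := by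
  simp [argE]

/-- **Value of the chosen symbol**: `[choice LF u p M]`. [folklore] -/
theorem bitE_apply (hind : ∀ v, indF v = [LF.boolIndicator v]) (u p : List Bool) (M : ℕ) :
    bitE indF (boolPair u (boolPair (ones M) p)) = [choice LF u p M] := by
  simp only [bitE, Function.comp_apply, fanoutFn_apply, argE_apply, estF_apply hind, ltFn_boolPair, bitsToNat_encodeNat,
    choice]

/-- **Value of one round.** [folklore] -/
theorem roundE_apply (hind : ∀ v, indF v = [LF.boolIndicator v]) (u p : List Bool) (M : ℕ) :
    roundE indF (boolPair u (boolPair (ones M) p)) = boolPair u (boolPair (ones M) (p ++ [choice LF u p M])) := by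
  simp only [roundE, fanoutFn_apply, fstF_boolPair, Function.comp_apply, sndF_boolPair, appF_boolPair, bitE_apply hind]

/-- **The rounds compute the greedy prefixes.** [folklore] -/
theorem iterate_roundE (hind : ∀ v, indF v = [LF.boolIndicator v]) (u : List Bool) (M : ℕ) :
    ∀ k : ℕ, (roundE indF)^[k] (boolPair u (boolPair (ones M) [])) = boolPair u (boolPair (ones M) (pref LF u M k))
  | 0 => rfl
  | k + 1 => by
    rw [Function.iterate_succ_apply', iterate_roundE hind u M k, roundE_apply hind, pref]

/-- **Value of the finder**: the greedy prefix of length `N = |u|` at resolution `M = m(|u|) + 1`. [folklore] -/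
theorem finderF_apply (hind : ∀ v, indF v = [LF.boolIndicator v]) (m : Polynomial ℕ) (u : List Bool) :
    finderF indF m u = pref LF u (m.eval u.length + 1) u.length := by
  have hinit : initE m u = boolPair u (boolPair (ones (m.eval u.length + 1)) []) := by
    simp [initE, ones, List.replicate_succ]
  simp only [finderF, Function.comp_apply, hinit, iterE, boolUnpair_boolPair, eval_X]
  rw [iterate_roundE hind, sndF_boolPair, sndF_boolPair]

/-- The chosen symbol is one symbol on every input. [folklore] -/
theorem oneBit_bitE : OneBit (bitE indF) := oneBit_ltFn.comp _

/-- The round keeps its first field. [folklore] -/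
theorem fst_roundE (w : List Bool) : (boolUnpair (roundE indF w)).1 = (boolUnpair w).1 := by
  simp [roundE, fstF]

/-- **The round grows its argument by at most `5` symbols** (on every input). [folklore] -/
theorem length_roundE_le (w : List Bool) : (roundE indF w).length ≤ w.length + 5 := by
  have h1 := length_fstF_sndF_le w
  have h2 := length_fstF_sndF_le (sndF w)
  have h3 : (bitE indF w).length = 1 := (oneBit_bitE (indF := indF)).length_eq w
  simp only [roundE, fanoutFn_apply, Function.comp_apply, length_boolPair, appF_boolPair, List.length_append, h3]
  omega

/-- `roundE ∈ FP`. [folklore] -/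
theorem roundE_mem_FP (hind : ∀ v, indF v = [LF.boolIndicator v]) (hindF : indF ∈ FP) : roundE indF ∈ FP := by
  have harg : ∀ b, argE b ∈ FP := fun b =>
    fanoutFn_mem_FP (fanoutFn_mem_FP fstF_mem_FP (comp_mem_FP appF_mem_FP (fanoutFn_mem_FP (comp_mem_FP sndF_mem_FP sndF_mem_FP)
      (const_mem_FP _)))) (comp_mem_FP fstF_mem_FP sndF_mem_FP)
  have hest := estF_mem_FP hind hindF
  have hbit : bitE indF ∈ FP :=
    comp_mem_FP ltFn_mem_FP (fanoutFn_mem_FP (comp_mem_FP hest (harg false)) (comp_mem_FP hest (harg true)))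
  exact fanoutFn_mem_FP fstF_mem_FP (fanoutFn_mem_FP (comp_mem_FP fstF_mem_FP sndF_mem_FP)
    (comp_mem_FP appF_mem_FP (fanoutFn_mem_FP (comp_mem_FP sndF_mem_FP sndF_mem_FP) hbit)))

/-- `iterE ∈ FP` (`N` rounds of a first-field-preserving round of constant growth). [Arora–Barak 2009, §1.4.1] [folklore] -/
theorem iterE_mem_FP (hind : ∀ v, indF v = [LF.boolIndicator v]) (hindF : indF ∈ FP) : iterE indF ∈ FP :=
  iterate_mem_FP_of_growth_poly (roundE_mem_FP hind hindF) 5 (fst_roundE (indF := indF))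
    (fun w => by simpa using length_roundE_le (indF := indF) w) X

/-- **`finderF ∈ FP`.** [Goldreich 2011, §3 (Thm. 3.5: "in deterministic polynomial time")] [folklore] -/
theorem finderF_mem_FP (hind : ∀ v, indF v = [LF.boolIndicator v]) (hindF : indF ∈ FP) (m : Polynomial ℕ) :
    finderF indF m ∈ FP := by
  have hinit : initE m ∈ FP :=
    fanoutFn_mem_FP (PolyTimeComputable.id _) (fanoutFn_mem_FP (comp_mem_FP (cons_mem_FP true) (polyFn_mem_FP m)) (const_mem_FP _))
  exact comp_mem_FP sndF_mem_FP (comp_mem_FP sndF_mem_FP (comp_mem_FP (iterE_mem_FP hind hindF) hinit))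

end Machines

/-! ### Main theorem -/

/-- **Finding an element of a dense polynomial-time decidable set, under `PromiseBPP' ⊆ PromiseP`.** For a
polynomial-time test `G` and a polynomial `m` there is — if `PromiseBPP' ⊆ PromiseP` — a polynomial-time
function `F` with `|F u| = |u|` for all `u`, such that `G (F u) = [1]` whenever the strings `w` of length
`N = |u|` with `G w = [1]` have density `> 2N/(m(N)+1)`. Proof: the threshold problem of conditional
densities is in `PromiseBPP'` by sampling (`thrProblem_mem_PromiseBPP'`), so it has a separator in `P`;
the greedy prefix extension driven by the separator's `1/M`-accurate estimates loses `≤ 2/M` of density per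
step (`dens_step`), hence ends at a good string (`good_pref`), and is computed in polynomial time
(`finderF_mem_FP`, `finderF_apply`). [Goldreich 2011, §3, Thm. 3.5 (BPP-search problems with efficiently
recognisable solutions are solvable deterministically if `pr-BPP = pr-P`); Arora–Barak 2009, §7.4.1]
[cite: Goldreich2011, §3, Thm. 3.5] -/
theorem exists_finder_of_PromiseBPP'_subset (hBPP : PromiseBPP' ⊆ PromiseP) {G : List Bool → List Bool}
    (hG : G ∈ FP) (m : Polynomial ℕ) :
    ∃ F : List Bool → List Bool, F ∈ FP ∧ ∀ u : List Bool, (F u).length = u.length ∧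
      (2 * (u.length : ℝ) / (m.eval u.length + 1 : ℕ) < uniformProb u.length {w | G w = [true]} → G (F u) = [true]) := by
  obtain ⟨LF, hLF, hyes, hno⟩ := hBPP (thrProblem_mem_PromiseBPP' hG)
  set indF : List Bool → List Bool := fun v => encodeBool (LF.boolIndicator v) with hindF
  have hind : ∀ v, indF v = [LF.boolIndicator v] := fun v => by
    simp only [hindF]; cases LF.boolIndicator v <;> rfl
  have hindFP : indF ∈ FP := indicatorFn_mem_FP hLF
  refine ⟨finderF indF m, finderF_mem_FP hind hindFP m, fun u => ?_⟩
  rw [finderF_apply hind]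
  refine ⟨length_pref _ _ _, fun hdense => good_pref hyes hno (by omega) ?_⟩
  rw [dens_nil]
  exact hdense

end DenseSearch

end Literature.Computability.Complexity

end
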